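import Literature.Barriers.CriticalPhenomena.PlaquetteWalkAllRootsClassification
import Literature.Barriers.CriticalPhenomena.PlaquetteWalkYBCurveIdentityAllSpins
import HarnessLib

/-!
# Barrier catalogue (SAWScalingLimit): the COMPLETE classification of exact plaquette vertex relations
on `ℤ²` in the row-convex class, `u₁u₂ ≠ 0`, every phase — the sixteen Yang–Baxter curves off `v = 0`,
Glazman's degenerate family on `v = 0`, nothing else

Assembly of three tree results and one new lemma. Off the boundary `v = 0`:
`PlaquetteWalkYBClassificationAllSpins_holds` (`PlaquetteWalkYBCurveIdentityAllSpins`: for `u₁u₂v ≠ 0`,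
`t ≠ 0`, a relation with some `c ≠ 0` on every ROW-CONVEX face list for every boundary root exists iff
`t¹⁶ = −1` and `W = ybCurve ε t r`). On `v = 0`: sufficiency is `exactPlaquetteVertexRelation_degen`
(`PlaquetteWalkDegenerateIdentity`: Glazman's family satisfies even the all-boundary-roots class, hole roots
included), and NECESSITY FROM THE ROW-CONVEX CLASS is this file's `degenerate_rigidityRC` — the tree's
`degenerate_rigidity` (all-roots class, `PlaquetteWalkSpinRigidity`) re-run on the row-convex instances
of `PlaquetteWalkYBClassification` (the one-, four- and six-face domains around `(0,0)` are row-convex):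
`t⁴ = 1`, `b² = t²a²` and the degenerate line. Hence:

* `exactPlaquetteVertexRelationRC_iff_degen` — `u₁u₂ ≠ 0`, `v = 0`, `t ≠ 0`:
  `(∃ c ≠ 0, ExactPlaquetteVertexRelationRC W t c) ↔ (t⁴ = 1 ∧ ∃ ε s = ±1, W = degenWeights ε s t u₁)`;
* ★ `exactPlaquetteVertexRelationRC_iff` / named **`PlaquetteWalkRowConvexClassification(_holds)`** —
  for ALL complex five-weight systems with `u₁u₂ ≠ 0` and every phase `t ≠ 0`, ONE technique class on
  both sides (row-convex face lists, boundary roots, constant coefficients):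
  `(∃ c ≠ 0, ExactPlaquetteVertexRelationRC W t c) ↔
     (v ≠ 0 ∧ t¹⁶ = −1 ∧ ∃ ε = ±1, ∃ r, W = ybCurve ε t r) ∨ (v = 0 ∧ t⁴ = 1 ∧ ∃ ε s = ±1, W = degenWeights ε s t u₁)` —
  the kernel form of Glazman's printed dichotomy "either `v = 0` or `σ = ℓ/8`" together with BOTH
  existence clauses of his Lemma 3.1 (Nienhuis' weights for `σ = ℓ/8`, `ℓ` odd; the one-parameter
  family for `σ = 1`), for arbitrary constant coefficient vectors and complex weights.
* (Appended, ed.2; ed.3 = docstring touches) the branches `u₁ = 0` / `u₂ = 0` in the row-convex class (one-plaquette rows from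
  the row-convex class; sufficiency descends from the all-boundary-roots class: no Yang–Baxter walk
  doubles all its corner plaquettes) and ★★ `exactPlaquetteVertexRelationRC_iff_all` / named
  **`PlaquetteWalkRowConvexClassificationAll(_holds)`**: the row-convex class classified on ALL of
  `ℂ⁵ × {t ≠ 0}` — YB curves, degenerate family, the two directed branches on their quartics, nothing else;
  and, subtracting `PlaquetteWalkAllRootsClassification` (imported): ★★ `rc_and_not_allRoots_iff_ybCurve` —
  the weight systems with a row-convex (outer-root) identity but no all-roots identity are EXACTLY the
  sixteen Yang–Baxter curves (`u₁u₂v ≠ 0`, `t¹⁶ = −1`).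

Sources: [cite: Glazman2015WeightedSAW, Lemma 3.1 (ECP 20 (2015) no. 86, pp. 5–7 and Appendix p. 12)];
[cite: GlazmanManolescu2019, Lemma 2.1]; [cite: IkhlefCardy2009, §3]; [cite: DuminilCopinSmirnov2012, Lemma 1].
Status in print: both existence statements and the dichotomy are printed for the LOCAL rhombus system
with Cauchy–Riemann-shaped coefficients on parallelograms (real weights); the typed two-sided
classification — arbitrary constant `c ∈ ℂ⁴`, complex weights, all sixteen spins resp. all four integer
spins with sign companions, row-convex face lists — is the venture lane's assembly (CONSOLIDATION AT KERNEL
RIGOUR + the lane's NEW-IN-WRITING modest extensions recorded in the two parent files); label owed.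

Implementation note: the row-convex instances and the algebraic core are private lemmas of
`PlaquetteWalkYBClassification` / `PlaquetteWalkSpinRigidity`, read via `open private … from` (as in
`PlaquetteWalkYBClassification` itself); nothing else is opened. Written for the venture lane «pcv-sawmu»
(Tier B, b-engine-1 gen 12).
-/

noncomputable section

open Complex

namespace Literature.Barriers.CriticalPhenomena

open Literature.Probability.RandomPlanarGeometry.SAW.YangBaxter

namespace PlaquetteWalk

open private inst_IE inst_IN inst_IW inst_IS inst_BNWE inst_BSEW inst_BSWE inst_BNEW forms_adj
  from Literature.Barriers.CriticalPhenomena.PlaquetteWalkYBClassification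
open private degenerate_of_forms exists_eps_component_ne_zero
  from Literature.Barriers.CriticalPhenomena.PlaquetteWalkSpinRigidity

section DegenerateRC

variable {W : CWeights} {t : ℂ} {c : Fin 4 → ℂ}

/-- The four adjacent-excursion forms `[E;NW]`, `[W;ES]`, `[E;WS]`, `[W;EN]` from the ROW-CONVEX class,
without the hypothesis `v ≠ 0` (box instances minus `t`, `t²` × the group-one rows, divided by `u₁u₂²`,
`u₁²u₂`). [cite: Glazman2015WeightedSAW, Lemma 3.1 (proof, eqs. (3.12)–(3.13))] -/
private theorem forms_adjE_RC (hrel : ExactPlaquetteVertexRelationRC W t c) (ht : t ≠ 0) (h1 : W.u₁ ≠ 0)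
    (h2 : W.u₂ ≠ 0) :
    (W.v * c 1 + W.u₂ * t ^ 5 * c 2 + W.w₂ * t ^ 4 * c 3 = 0) ∧
    (W.u₂ * t ^ 5 * c 0 + W.w₂ * t ^ 4 * c 1 + W.v * c 3 = 0) ∧
    (W.w₁ * t * c 1 + W.u₁ * c 2 + W.v * t ^ 5 * c 3 = 0) ∧
    (W.u₁ * c 0 + W.v * t ^ 5 * c 1 + W.w₁ * t * c 3 = 0) := by
  have hIE := inst_IE hrel ht
  have hIW := inst_IW hrel ht
  have hBNWE := inst_BNWE hrel ht
  have hBSEW := inst_BSEW hrel ht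
  have hBSWE := inst_BSWE hrel ht
  have hBNEW := inst_BNEW hrel ht
  have m12 : W.u₁ * W.u₂ ^ 2 ≠ 0 := mul_ne_zero h1 (pow_ne_zero _ h2)
  have m21 : W.u₁ ^ 2 * W.u₂ ≠ 0 := mul_ne_zero (pow_ne_zero _ h1) h2
  refine ⟨?_, ?_, ?_, ?_⟩
  · have h : W.u₁ * W.u₂ ^ 2 * (W.v * c 1 + W.u₂ * t ^ 5 * c 2 + W.w₂ * t ^ 4 * c 3) = 0 := by
      linear_combination hBNWE - t ^ 2 * hIE
    exact (mul_eq_zero.1 h).resolve_left m12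
  · have h : W.u₁ * W.u₂ ^ 2 * (W.u₂ * t ^ 5 * c 0 + W.w₂ * t ^ 4 * c 1 + W.v * c 3) = 0 := by
      linear_combination hBSEW - t ^ 2 * hIW
    exact (mul_eq_zero.1 h).resolve_left m12
  · have h : W.u₁ ^ 2 * W.u₂ * (W.w₁ * t * c 1 + W.u₁ * c 2 + W.v * t ^ 5 * c 3) = 0 := by
      linear_combination hBSWE - t * hIE
    exact (mul_eq_zero.1 h).resolve_left m21
  · have h : W.u₁ ^ 2 * W.u₂ * (W.u₁ * c 0 + W.v * t ^ 5 * c 1 + W.w₁ * t * c 3) = 0 := by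
      linear_combination hBNEW - t * hIW
    exact (mul_eq_zero.1 h).resolve_left m21

/-- **Degenerate (`v = 0`) rigidity from the ROW-CONVEX class**: a relation with `v = 0`, `u₁u₂ ≠ 0`,
`t ≠ 0`, `c ≠ 0` on every row-convex face list forces `t⁴ = 1` and, for a sign `ε` with nonzero
`ρ²`-eigencomponent `(a, b) = (c_E + εc_W, c_N + εc_S)`: `a ≠ 0`, `b ≠ 0`, `b² = t²a²`,
`u₂ t² a = −ε u₁ a − t b`, `w₁ a = −ε u₁ t b`, `w₂ t a = −u₂ b` (the tree's `degenerate_rigidity`, same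
algebra, row-convex instances). [cite: Glazman2015WeightedSAW, Lemma 3.1 (σ = 1: the degenerate family u₁ + u₂ = 1, w₁ = u₁, w₂ = u₂)] -/
theorem degenerate_rigidityRC (hrel : ExactPlaquetteVertexRelationRC W t c) (ht : t ≠ 0) (h1 : W.u₁ ≠ 0)
    (h2 : W.u₂ ≠ 0) (hv : W.v = 0) (hc : c ≠ 0) :
    t ^ 4 = 1 ∧ ∃ ε : ℂ, (ε = 1 ∨ ε = -1) ∧
      (c 0 + ε * c 2) ≠ 0 ∧ (c 1 + ε * c 3) ≠ 0 ∧
      (c 1 + ε * c 3) ^ 2 = t ^ 2 * (c 0 + ε * c 2) ^ 2 ∧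
      W.u₂ * t ^ 2 * (c 0 + ε * c 2) = -ε * W.u₁ * (c 0 + ε * c 2) - t * (c 1 + ε * c 3) ∧
      W.w₁ * (c 0 + ε * c 2) = -ε * W.u₁ * t * (c 1 + ε * c 3) ∧
      W.w₂ * t * (c 0 + ε * c 2) = -W.u₂ * (c 1 + ε * c 3) := by
  obtain ⟨fA1, fA1', fB1, fB1'⟩ := forms_adjE_RC hrel ht h1 h2
  obtain ⟨fC1, fC1', fE1, fE1'⟩ := forms_adj hrel ht h1 h2
  obtain ⟨ε, hε, hab⟩ := exists_eps_component_ne_zero hc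
  obtain ⟨ha, hb, ht4, hbt, hR3, hR2, hR1⟩ := degenerate_of_forms ht h1 h2 hv (inst_IN hrel ht)
    (inst_IS hrel ht) fA1 fA1' fB1 fB1' fC1 fC1' fE1 fE1' hε hab
  exact ⟨ht4, ε, hε, ha, hb, hbt, hR3, hR2, hR1⟩

/-- **Two-sided classification of the `v = 0` boundary in the ROW-CONVEX class** (`u₁u₂ ≠ 0`, any
`t ≠ 0`): a nonzero exact vertex relation on every row-convex face list exists iff `t⁴ = 1` and the
weights belong to the degenerate family — which then satisfies even the all-boundary-roots class
(`exactPlaquetteVertexRelation_degen`). [cite: Glazman2015WeightedSAW, Lemma 3.1 (proof p. 7: "If v = 0, the solution exists for each θ if and only if σ = 1")] -/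
theorem exactPlaquetteVertexRelationRC_iff_degen (W : CWeights) {t : ℂ} (ht : t ≠ 0) (h1 : W.u₁ ≠ 0)
    (h2 : W.u₂ ≠ 0) (hv : W.v = 0) :
    (∃ c : Fin 4 → ℂ, c ≠ 0 ∧ ExactPlaquetteVertexRelationRC W t c) ↔
      (t ^ 4 = 1 ∧ ∃ ε s : ℂ, (ε = 1 ∨ ε = -1) ∧ (s = 1 ∨ s = -1) ∧ W = degenWeights ε s t W.u₁) := by
  constructor
  · rintro ⟨c, hc, hrel⟩
    obtain ⟨ht4, ε, hε, ha0, hb0, hbt, hR3, hR2, hR1⟩ := degenerate_rigidityRC hrel ht h1 h2 hv hc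
    have htA : t * (c 0 + ε * c 2) ≠ 0 := mul_ne_zero ht ha0
    obtain ⟨σ, hBσ⟩ : ∃ σ : ℂ, c 1 + ε * c 3 = σ * t * (c 0 + ε * c 2) :=
      ⟨(c 1 + ε * c 3) / (t * (c 0 + ε * c 2)), by field_simp⟩
    have hσ2 : σ ^ 2 = 1 := by
      have h : (t * (c 0 + ε * c 2)) ^ 2 * (σ ^ 2 - 1) = 0 := by
        rw [hBσ] at hbt; linear_combination hbt
      linear_combination (mul_eq_zero.1 h).resolve_left (pow_ne_zero _ htA)
    refine ⟨ht4, ε, σ, hε, ?_, ?_⟩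
    · have h : (σ - 1) * (σ + 1) = 0 := by linear_combination hσ2
      rcases mul_eq_zero.1 h with h | h
      · left; linear_combination h
      · right; linear_combination h
    · obtain ⟨u₁, u₂, v, w₁, w₂⟩ := W
      simp only at h1 h2 hv hR3 hR2 hR1 ⊢
      subst hv
      rw [hBσ] at hR3 hR2 hR1
      have hu₂' := (mul_eq_zero.1 (show (c 0 + ε * c 2) * (u₂ * t ^ 2 + ε * u₁ + σ * t ^ 2) = 0 by
        linear_combination hR3)).resolve_left ha0
      have hu₂ : u₂ = -σ - ε * t ^ 2 * u₁ := by linear_combination t ^ 2 * hu₂' - (u₂ + σ) * ht4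
      have hw₁ := (mul_eq_zero.1 (show (c 0 + ε * c 2) * (w₁ + ε * σ * t ^ 2 * u₁) = 0 by
        linear_combination hR2)).resolve_left ha0
      have hw₂ := (mul_eq_zero.1 (show t * (c 0 + ε * c 2) * (w₂ + σ * u₂) = 0 by
        linear_combination hR1)).resolve_left htA
      simp only [degenWeights, CWeights.mk.injEq, true_and]
      exact ⟨hu₂, by linear_combination hw₁, by linear_combination hw₂ - σ * hu₂⟩
  · rintro ⟨ht4, ε, s, hε, hs, hW⟩
    refine ⟨degenCoeff ε s t, degenCoeff_ne_zero ε s t, ?_⟩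
    rw [hW]
    exact (exactPlaquetteVertexRelation_degen ht4 hε hs W.u₁).toRC

end DegenerateRC

/-- ★ **The complete classification in the row-convex class** (`u₁u₂ ≠ 0`, every phase `t ≠ 0`): an exact
plaquette vertex relation with some nonzero constant coefficient vector on every row-convex face list for
every boundary root exists iff EITHER `v ≠ 0`, the spin is admissible (`t¹⁶ = −1`) and the weights lie on
one of the sixteen complexified Yang–Baxter curves, OR `v = 0`, the spin is an integer (`t⁴ = 1`) and the
weights belong to Glazman's degenerate family. [cite: Glazman2015WeightedSAW, Lemma 3.1 ("either v = 0 or σ = ℓ/8"; the weights (3.3)–(3.7); the σ = 1 family (3.8)–(3.10))] -/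
theorem exactPlaquetteVertexRelationRC_iff (W : CWeights) {t : ℂ} (ht : t ≠ 0) (h1 : W.u₁ ≠ 0)
    (h2 : W.u₂ ≠ 0) :
    (∃ c : Fin 4 → ℂ, c ≠ 0 ∧ ExactPlaquetteVertexRelationRC W t c) ↔
      (W.v ≠ 0 ∧ t ^ 16 = -1 ∧ ∃ ε r : ℂ, (ε = 1 ∨ ε = -1) ∧ W = ybCurve ε t r) ∨
      (W.v = 0 ∧ t ^ 4 = 1 ∧ ∃ ε s : ℂ, (ε = 1 ∨ ε = -1) ∧ (s = 1 ∨ s = -1) ∧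
        W = degenWeights ε s t W.u₁) := by
  by_cases hv : W.v = 0
  · rw [exactPlaquetteVertexRelationRC_iff_degen W ht h1 h2 hv]
    constructor
    · exact fun h => Or.inr ⟨hv, h⟩
    · rintro (⟨hv', -⟩ | ⟨-, h⟩)
      · exact (hv' hv).elim
      · exact h
  · rw [PlaquetteWalkYBClassificationAllSpins_holds W t ht h1 h2 hv]
    constructor
    · exact fun h => Or.inl ⟨hv, h⟩
    · rintro (⟨-, h⟩ | ⟨hv', -⟩)
      · exact h
      · exact (hv hv').elim

/-- **Barrier `PlaquetteWalkRowConvexClassification`** (named statement): the COMPLETE two-sided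
classification of exact constant-coefficient plaquette vertex relations on `ℤ²` in the row-convex class,
for all complex five-weight systems with `u₁u₂ ≠ 0` and every phase `t ≠ 0`. A THEOREM of this file
(`PlaquetteWalkRowConvexClassification_holds`).

BARRIER (structured block, D-0021):
- technique_class: plaquette-local linear vertex relations `Σ_{s ∈ (E,N,W,S)} c_s F(z_s) = 0`, constant `c ∈ ℂ⁴ ∖ {0}`, for the Glazman–Manolescu plaquette walk on `ℤ²` with complex weights `(u₁, u₂, v, w₁, w₂)`, `u₁u₂ ≠ 0`, phase `t ≠ 0` per left quarter turn, demanded at every face of every ROW-CONVEX finite face list for every boundary root — `ExactPlaquetteVertexRelationRC W t c` of `PlaquetteWalkYBClassification`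
- blocks: every exact identity in this class off the two families: off `v = 0` anything not on a Yang–Baxter curve `ybCurve ε t r` at an admissible spin `t¹⁶ = −1` (in particular the uniform SAW `(x, x, x, 0, 0)` and every no-touch system); on `v = 0` anything at non-integer spin or off the degenerate lines; conversely it PROVIDES the identities on both families (the Yang–Baxter ones for OUTER roots on all face lists — `PlaquetteWalkYBCurveIdentityAllSpins` — and at hole roots they FAIL, `PlaquetteWalkNoAllRootsRelation`; the degenerate ones at EVERY boundary root, `PlaquetteWalkDegenerateIdentity`)
- because: `v ≠ 0`: `PlaquetteWalkYBClassificationAllSpins_holds` (spin + weight rigidity from row-convex instances; sufficiency by Galois conjugation of the `σ = 5/8` identity); `v = 0`: `degenerate_rigidityRC` (row-convex instances + the tree's algebraic core) and `exactPlaquetteVertexRelation_degen` (last-arc grouping)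
- evasions_known: leave the class — the branches `u₁ = 0` / `u₂ = 0` (outside THIS statement's hypothesis `u₁u₂ ≠ 0`; classified in the appended section `BranchesRC` / `PlaquetteWalkRowConvexClassificationAll` of this file), non-constant or root-dependent coefficients (defect identities at hole roots, `PlaquetteWalkIsthmusRoot`), multi-vertex or non-linear relations, other observables (no winding weight / other spins per arc), other lattices
- scope_caveats: EXACT identities only; the classification is of WEIGHT SYSTEMS admitting SOME nonzero coefficient vector (the vector is then forced up to scale off `v = 0`: `PlaquetteWalkYBCoefficientRigidity`; on `v = 0` the `ε`-component is forced, `degenerate_rigidityRC`); hole-free / simply connected sub-classes are not separately classified here (necessity uses row-convex instances only, so the same statement holds for any class containing them)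
- status: established — `PlaquetteWalkRowConvexClassification_holds` (this file); print: [cite: Glazman2015WeightedSAW, Lemma 3.1 (pp. 5–7, Appendix p. 12)] [cite: IkhlefCardy2009, §3] (local system, Cauchy–Riemann coefficients, real weights) — the typed complex/arbitrary-coefficient two-sided form is the venture lane's assembly
[cite: Glazman2015WeightedSAW, Lemma 3.1] [cite: GlazmanManolescu2019, Lemma 2.1] -/
def _root_.Literature.Barriers.CriticalPhenomena.PlaquetteWalkRowConvexClassification : Prop :=
  ∀ (W : CWeights) (t : ℂ), t ≠ 0 → W.u₁ ≠ 0 → W.u₂ ≠ 0 →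
    ((∃ c : Fin 4 → ℂ, c ≠ 0 ∧ ExactPlaquetteVertexRelationRC W t c) ↔
      (W.v ≠ 0 ∧ t ^ 16 = -1 ∧ ∃ ε r : ℂ, (ε = 1 ∨ ε = -1) ∧ W = ybCurve ε t r) ∨
      (W.v = 0 ∧ t ^ 4 = 1 ∧ ∃ ε s : ℂ, (ε = 1 ∨ ε = -1) ∧ (s = 1 ∨ s = -1) ∧
        W = degenWeights ε s t W.u₁))

/-- **`PlaquetteWalkRowConvexClassification` holds.** [cite: Glazman2015WeightedSAW, Lemma 3.1] -/
theorem _root_.Literature.Barriers.CriticalPhenomena.PlaquetteWalkRowConvexClassification_holds :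
    PlaquetteWalkRowConvexClassification :=
  fun W _ ht h1 h2 => exactPlaquetteVertexRelationRC_iff W ht h1 h2

/-! ### Appended (ed.2): the branches `u₁ = 0` and `u₂ = 0` in the row-convex class — the row-convex class
classified on ALL of `ℂ⁵ × {t ≠ 0}`

The one-plaquette face list `[f₀]` is row-convex, so every relation of the ROW-CONVEX class satisfies the
four group-one rows (`groupOne_row_of_exactPlaquetteVertexRelationRC`, via the tree's
`vertexFunctional_single`); the rows alone force the quartic on the branches `u₁ = 0` / `u₂ = 0`
(`quartic_eq_zero_of_rows_of_u₁_eq_zero` / `_of_u₂_eq_zero`, the algebra of the tree's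
`quartic_eq_zero_of_exactPlaquetteVertexRelation_of_u₁_eq_zero` / `_of_u₂_eq_zero` run from the rows),
and sufficiency descends from the all-boundary-roots class (`exactPlaquetteVertexRelation_iff_quartic_of_u₁_eq_zero`
/ `_of_u₂_eq_zero` of `PlaquetteWalkDegenerateIdentity`, appended section «corner slivers»: no Yang–Baxter
walk doubles all its corner plaquettes) by `ExactPlaquetteVertexRelation.toRC`. Hence the two branch
classifications hold verbatim in the row-convex class, and with `exactPlaquetteVertexRelationRC_iff` the
row-convex class is classified on all of `ℂ⁵ × {t ≠ 0}`:
★★ `exactPlaquetteVertexRelationRC_iff_all` / named **`PlaquetteWalkRowConvexClassificationAll(_holds)`**.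
Written for the venture lane «pcv-sawmu» (Tier B, b-engine-1 gen 13). -/

section BranchesRC

variable {W : CWeights} {t : ℂ} {c : Fin 4 → ℂ}

/-- A one-plaquette face list is row-convex. [cite: GlazmanManolescu2019, §2.1 (the rectangles Rect_{T,L}: a single rhombus)] -/
private theorem rowConvex_single (f₀ : Face) : RowConvex [f₀] := by
  intro f hf g hg _ hlt
  rw [List.mem_singleton] at hf hg
  rw [hf, hg] at hlt
  exact absurd hlt (lt_irrefl _)

/-- A side of a plaquette is a boundary root of the one-plaquette face list. [folklore] -/
private theorem isBoundaryRoot_single' (f₀ : Face) (p : Side) : IsBoundaryRoot [f₀] (f₀.side p) := by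
  obtain ⟨x, y⟩ := f₀
  unfold IsBoundaryRoot
  cases p <;> simp [Face.side, MidEdge.faces]

/-- The sum over the four sides. [folklore] -/
private theorem sum_side' (g : Side → ℂ) : ∑ x : Side, g x = g .W + g .E + g .S + g .N := by
  rw [show (Finset.univ : Finset Side) = {Side.W, Side.E, Side.S, Side.N} from by ext x; cases x <;> simp]
  simp [Finset.sum_insert, add_assoc]

/-- **Every relation of the ROW-CONVEX class satisfies the four group-one rows** (arbitrary complex weights):
the one-plaquette face list is row-convex and its vertex functional rooted at the side `p` is the row
(`vertexFunctional_single`). [cite: Glazman2015WeightedSAW, Lemma 3.1 (proof, eq. (3.11): the one-visit group)] -/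
theorem groupOne_row_of_exactPlaquetteVertexRelationRC (hrel : ExactPlaquetteVertexRelationRC W t c)
    (p : Side) :
    ∑ x : Side, c (slotIdx x) * arcW W (arcKind p x) * t ^ qTurn p x = 0 := by
  rw [← vertexFunctional_single W t c (0, 0) p]
  exact hrel _ _ _ (rowConvex_single _) (List.mem_singleton_self _) (isBoundaryRoot_single' (0, 0) p)

/-- **The four rows force the quartic on the branch `u₁ = 0`** (any `u₂, v, w₁, w₂`, any phase `t ≠ 0`,
`c ≠ 0`): the algebra of `quartic_eq_zero_of_exactPlaquetteVertexRelation_of_u₁_eq_zero`, run from the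
rows alone. [cite: Glazman2015WeightedSAW, Lemma 3.1 (proof: "solving this linear system")] -/
theorem quartic_eq_zero_of_rows_of_u₁_eq_zero
    (hrow : ∀ p : Side, ∑ x : Side, c (slotIdx x) * arcW W (arcKind p x) * t ^ qTurn p x = 0)
    (ht : t ≠ 0) (h1 : W.u₁ = 0) (hc : c ≠ 0) :
    (1 + W.v - W.u₂) * (1 + W.v + W.u₂) * (1 - W.v - W.u₂) * (1 - W.v + W.u₂) = 0 := by
  have rE := hrow .E
  have rN := hrow .N
  have rW := hrow .W
  have rS := hrow .S
  rw [sum_side'] at rE rN rW rS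
  simp only [slotIdx, arcKind, arcW, qTurn, h1, zpow_zero, zpow_one, zpow_neg, mul_one, mul_zero,
    zero_mul, add_zero, zero_add, Int.reduceNeg] at rE rN rW rS
  have hti : t * t⁻¹ = 1 := mul_inv_cancel₀ ht
  -- sums and differences of opposite rows (the `ρ²`-eigencomponents)
  have hA : (1 + W.v) * (c 0 + c 2) * t + W.u₂ * (c 1 + c 3) = 0 := by
    linear_combination t * rE + t * rW - (W.u₂ * (c 1 + c 3)) * hti
  have hB : W.u₂ * (c 0 + c 2) * t + (1 + W.v) * (c 1 + c 3) = 0 := by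
    linear_combination rN + rS
  have hA' : (1 - W.v) * (c 0 - c 2) * t + W.u₂ * (c 1 - c 3) = 0 := by
    linear_combination t * rE - t * rW - (W.u₂ * (c 1 - c 3)) * hti
  have hB' : W.u₂ * (c 0 - c 2) * t + (1 - W.v) * (c 1 - c 3) = 0 := by
    linear_combination rN - rS
  -- the two 2×2 determinants
  have hP : ((1 + W.v) ^ 2 - W.u₂ ^ 2) * ((c 0 + c 2) * t) = 0 := by
    linear_combination (1 + W.v) * hA - W.u₂ * hB
  have hP2 : ((1 + W.v) ^ 2 - W.u₂ ^ 2) * (c 1 + c 3) = 0 := by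
    linear_combination (1 + W.v) * hB - W.u₂ * hA
  have hM : ((1 - W.v) ^ 2 - W.u₂ ^ 2) * ((c 0 - c 2) * t) = 0 := by
    linear_combination (1 - W.v) * hA' - W.u₂ * hB'
  have hM2 : ((1 - W.v) ^ 2 - W.u₂ ^ 2) * (c 1 - c 3) = 0 := by
    linear_combination (1 - W.v) * hB' - W.u₂ * hA'
  by_contra hq
  have hp : (1 + W.v) ^ 2 - W.u₂ ^ 2 ≠ 0 := by
    intro h0; apply hq; linear_combination ((1 - W.v - W.u₂) * (1 - W.v + W.u₂)) * h0
  have hm : (1 - W.v) ^ 2 - W.u₂ ^ 2 ≠ 0 := by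
    intro h0; apply hq; linear_combination ((1 + W.v - W.u₂) * (1 + W.v + W.u₂)) * h0
  have e1 : c 0 + c 2 = 0 :=
    (mul_eq_zero.1 ((mul_eq_zero.1 hP).resolve_left hp)).resolve_right ht
  have e2 : c 1 + c 3 = 0 := (mul_eq_zero.1 hP2).resolve_left hp
  have e3 : c 0 - c 2 = 0 :=
    (mul_eq_zero.1 ((mul_eq_zero.1 hM).resolve_left hm)).resolve_right ht
  have e4 : c 1 - c 3 = 0 := (mul_eq_zero.1 hM2).resolve_left hm
  apply hc
  funext i
  fin_cases i
  · show c 0 = 0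
    linear_combination (e1 + e3) / 2
  · show c 1 = 0
    linear_combination (e2 + e4) / 2
  · show c 2 = 0
    linear_combination (e1 - e3) / 2
  · show c 3 = 0
    linear_combination (e2 - e4) / 2

/-- **The four rows force the quartic on the branch `u₂ = 0`** (mirror). [cite: Glazman2015WeightedSAW, Lemma 3.1 (proof: "solving this linear system")] -/
theorem quartic_eq_zero_of_rows_of_u₂_eq_zero
    (hrow : ∀ p : Side, ∑ x : Side, c (slotIdx x) * arcW W (arcKind p x) * t ^ qTurn p x = 0)
    (ht : t ≠ 0) (h2 : W.u₂ = 0) (hc : c ≠ 0) :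
    (1 + W.v - W.u₁) * (1 + W.v + W.u₁) * (1 - W.v - W.u₁) * (1 - W.v + W.u₁) = 0 := by
  have rE := hrow .E
  have rN := hrow .N
  have rW := hrow .W
  have rS := hrow .S
  rw [sum_side'] at rE rN rW rS
  simp only [slotIdx, arcKind, arcW, qTurn, h2, zpow_zero, zpow_one, zpow_neg, mul_one, mul_zero,
    zero_mul, add_zero, zero_add, Int.reduceNeg] at rE rN rW rS
  have hti : t * t⁻¹ = 1 := mul_inv_cancel₀ ht
  -- rows (u₂ = 0): E: c0 + c3 u₁ t + c2 v; N: c1 + c2 u₁ t⁻¹ + c3 v; W: c2 + c1 u₁ t + c0 v; S: c3 + c0 u₁ t⁻¹ + c1 v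
  have hA : (1 + W.v) * (c 0 + c 2) + W.u₁ * t * (c 1 + c 3) = 0 := by
    linear_combination rE + rW
  have hB : W.u₁ * (c 0 + c 2) + (1 + W.v) * t * (c 1 + c 3) = 0 := by
    linear_combination t * rN + t * rS - (W.u₁ * (c 0 + c 2)) * hti
  have hA' : (1 - W.v) * (c 0 - c 2) - W.u₁ * t * (c 1 - c 3) = 0 := by
    linear_combination rE - rW
  have hB' : -(W.u₁ * (c 0 - c 2)) + (1 - W.v) * t * (c 1 - c 3) = 0 := by
    linear_combination t * rN - t * rS + (W.u₁ * (c 0 - c 2)) * hti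
  have hP : ((1 + W.v) ^ 2 - W.u₁ ^ 2) * (c 0 + c 2) = 0 := by
    linear_combination (1 + W.v) * hA - W.u₁ * hB
  have hP2 : ((1 + W.v) ^ 2 - W.u₁ ^ 2) * ((c 1 + c 3) * t) = 0 := by
    linear_combination (1 + W.v) * hB - W.u₁ * hA
  have hM : ((1 - W.v) ^ 2 - W.u₁ ^ 2) * (c 0 - c 2) = 0 := by
    linear_combination (1 - W.v) * hA' + W.u₁ * hB'
  have hM2 : ((1 - W.v) ^ 2 - W.u₁ ^ 2) * ((c 1 - c 3) * t) = 0 := by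
    linear_combination (1 - W.v) * hB' + W.u₁ * hA'
  by_contra hq
  have hp : (1 + W.v) ^ 2 - W.u₁ ^ 2 ≠ 0 := by
    intro h0; apply hq; linear_combination ((1 - W.v - W.u₁) * (1 - W.v + W.u₁)) * h0
  have hm : (1 - W.v) ^ 2 - W.u₁ ^ 2 ≠ 0 := by
    intro h0; apply hq; linear_combination ((1 + W.v - W.u₁) * (1 + W.v + W.u₁)) * h0
  have e1 : c 0 + c 2 = 0 := (mul_eq_zero.1 hP).resolve_left hp
  have e2 : c 1 + c 3 = 0 := (mul_eq_zero.1 ((mul_eq_zero.1 hP2).resolve_left hp)).resolve_right ht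
  have e3 : c 0 - c 2 = 0 := (mul_eq_zero.1 hM).resolve_left hm
  have e4 : c 1 - c 3 = 0 := (mul_eq_zero.1 ((mul_eq_zero.1 hM2).resolve_left hm)).resolve_right ht
  apply hc
  funext i
  fin_cases i
  · show c 0 = 0
    linear_combination (e1 + e3) / 2
  · show c 1 = 0
    linear_combination (e2 + e4) / 2
  · show c 2 = 0
    linear_combination (e1 - e3) / 2
  · show c 3 = 0
    linear_combination (e2 - e4) / 2

/-- ★ **The branch `u₁ = 0` in the ROW-CONVEX class** (any `u₂, v, w₁, w₂ ∈ ℂ`, any phase `t ≠ 0`): a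
nonzero exact vertex relation on every row-convex face list for every boundary root exists iff
`(1+v−u₂)(1+v+u₂)(1−v−u₂)(1−v+u₂) = 0` — the same quartic as for the all-boundary-roots class
(`exactPlaquetteVertexRelation_iff_quartic_of_u₁_eq_zero`), whose solutions descend by `toRC`.
[cite: Glazman2015WeightedSAW, Lemma 3.1 (proof: "solving this linear system")] -/
theorem exactPlaquetteVertexRelationRC_iff_quartic_of_u₁_eq_zero (W : CWeights) {t : ℂ} (ht : t ≠ 0)
    (h1 : W.u₁ = 0) :
    (∃ c : Fin 4 → ℂ, c ≠ 0 ∧ ExactPlaquetteVertexRelationRC W t c) ↔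
      (1 + W.v - W.u₂) * (1 + W.v + W.u₂) * (1 - W.v - W.u₂) * (1 - W.v + W.u₂) = 0 := by
  constructor
  · rintro ⟨c, hc, hrel⟩
    exact quartic_eq_zero_of_rows_of_u₁_eq_zero (groupOne_row_of_exactPlaquetteVertexRelationRC hrel) ht h1 hc
  · intro hq
    obtain ⟨c, hc, hrel⟩ := (exactPlaquetteVertexRelation_iff_quartic_of_u₁_eq_zero W ht h1).2 hq
    exact ⟨c, hc, hrel.toRC⟩

/-- ★ **The branch `u₂ = 0` in the ROW-CONVEX class** (mirror): iff `(1+v−u₁)(1+v+u₁)(1−v−u₁)(1−v+u₁) = 0`.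
[cite: Glazman2015WeightedSAW, Lemma 3.1 (proof: "solving this linear system")] -/
theorem exactPlaquetteVertexRelationRC_iff_quartic_of_u₂_eq_zero (W : CWeights) {t : ℂ} (ht : t ≠ 0)
    (h2 : W.u₂ = 0) :
    (∃ c : Fin 4 → ℂ, c ≠ 0 ∧ ExactPlaquetteVertexRelationRC W t c) ↔
      (1 + W.v - W.u₁) * (1 + W.v + W.u₁) * (1 - W.v - W.u₁) * (1 - W.v + W.u₁) = 0 := by
  constructor
  · rintro ⟨c, hc, hrel⟩
    exact quartic_eq_zero_of_rows_of_u₂_eq_zero (groupOne_row_of_exactPlaquetteVertexRelationRC hrel) ht h2 hc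
  · intro hq
    obtain ⟨c, hc, hrel⟩ := (exactPlaquetteVertexRelation_iff_quartic_of_u₂_eq_zero W ht h2).2 hq
    exact ⟨c, hc, hrel.toRC⟩

/-- ★★ **The row-convex class, classified on all of `ℂ⁵ × {t ≠ 0}`**: for complex plaquette weights `W`
and any phase `t ≠ 0`, a nonzero exact constant-coefficient vertex relation on every ROW-CONVEX face list
for every boundary root EXISTS iff one of: `u₁u₂ ≠ 0`, `v ≠ 0`, admissible spin `t¹⁶ = −1` and `W` on one
of the sixteen Yang–Baxter curves; `u₁u₂ ≠ 0`, `v = 0`, integer spin `t⁴ = 1` and `W` in Glazman's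
degenerate family; `u₁ = 0` and `(1+v−u₂)(1+v+u₂)(1−v−u₂)(1−v+u₂) = 0`; `u₂ = 0` and the same quartic in
`u₁`. [cite: Glazman2015WeightedSAW, Lemma 3.1 ("either v = 0 or σ = ℓ/8"; (3.3)–(3.7); (3.8)–(3.10))] -/
theorem exactPlaquetteVertexRelationRC_iff_all (W : CWeights) {t : ℂ} (ht : t ≠ 0) :
    (∃ c : Fin 4 → ℂ, c ≠ 0 ∧ ExactPlaquetteVertexRelationRC W t c) ↔
      ((W.u₁ ≠ 0 ∧ W.u₂ ≠ 0 ∧ W.v ≠ 0 ∧ t ^ 16 = -1 ∧ ∃ ε r : ℂ, (ε = 1 ∨ ε = -1) ∧ W = ybCurve ε t r) ∨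
        (W.u₁ ≠ 0 ∧ W.u₂ ≠ 0 ∧ W.v = 0 ∧ t ^ 4 = 1 ∧
          ∃ ε s : ℂ, (ε = 1 ∨ ε = -1) ∧ (s = 1 ∨ s = -1) ∧ W = degenWeights ε s t W.u₁) ∨
        (W.u₁ = 0 ∧ (1 + W.v - W.u₂) * (1 + W.v + W.u₂) * (1 - W.v - W.u₂) * (1 - W.v + W.u₂) = 0) ∨
        (W.u₂ = 0 ∧ (1 + W.v - W.u₁) * (1 + W.v + W.u₁) * (1 - W.v - W.u₁) * (1 - W.v + W.u₁) = 0)) := by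
  by_cases h1 : W.u₁ = 0
  · rw [exactPlaquetteVertexRelationRC_iff_quartic_of_u₁_eq_zero W ht h1]
    constructor
    · intro hq
      exact Or.inr (Or.inr (Or.inl ⟨h1, hq⟩))
    · rintro (⟨h1', -⟩ | ⟨h1', -⟩ | ⟨-, hq⟩ | ⟨h2, hq⟩)
      · exact (h1' h1).elim
      · exact (h1' h1).elim
      · exact hq
      · rw [h2]; rw [h1] at hq
        linear_combination hq
  · by_cases h2 : W.u₂ = 0
    · rw [exactPlaquetteVertexRelationRC_iff_quartic_of_u₂_eq_zero W ht h2]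
      constructor
      · intro hq
        exact Or.inr (Or.inr (Or.inr ⟨h2, hq⟩))
      · rintro (⟨-, h2', -⟩ | ⟨-, h2', -⟩ | ⟨h1', -⟩ | ⟨-, hq⟩)
        · exact (h2' h2).elim
        · exact (h2' h2).elim
        · exact (h1 h1').elim
        · exact hq
    · rw [exactPlaquetteVertexRelationRC_iff W ht h1 h2]
      constructor
      · rintro (⟨hv, h16, hfam⟩ | ⟨hv, h4, hfam⟩)
        · exact Or.inl ⟨h1, h2, hv, h16, hfam⟩
        · exact Or.inr (Or.inl ⟨h1, h2, hv, h4, hfam⟩)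
      · rintro (⟨-, -, hv, h16, hfam⟩ | ⟨-, -, hv, h4, hfam⟩ | ⟨h1', -⟩ | ⟨h2', -⟩)
        · exact Or.inl ⟨hv, h16, hfam⟩
        · exact Or.inr ⟨hv, h4, hfam⟩
        · exact (h1 h1').elim
        · exact (h2 h2').elim

/-- **Barrier `PlaquetteWalkRowConvexClassificationAll`** (named statement): the COMPLETE two-sided
classification of exact constant-coefficient plaquette vertex relations on `ℤ²` in the row-convex class,
for ALL complex five-weight systems and every phase `t ≠ 0` — the sixteen Yang–Baxter curves
(`u₁u₂v ≠ 0`, `t¹⁶ = −1`), Glazman's degenerate family (`u₁u₂ ≠ 0`, `v = 0`, `t⁴ = 1`), the directed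
branches `u₁ = 0` / `u₂ = 0` on their quartics `(1 ± v)² = u²`, and nothing else. A THEOREM of this file
(`PlaquetteWalkRowConvexClassificationAll_holds`).

BARRIER (structured block, D-0021):
- technique_class: plaquette-local linear vertex relations `Σ_{s ∈ (E,N,W,S)} c_s F(z_s) = 0`, constant `c ∈ ℂ⁴ ∖ {0}`, for the Glazman–Manolescu plaquette walk on `ℤ²` with ANY complex weights `(u₁, u₂, v, w₁, w₂) ∈ ℂ⁵` and phase `t ≠ 0` per left quarter turn, demanded at every face of every ROW-CONVEX finite face list for every boundary root — `ExactPlaquetteVertexRelationRC W t c`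
- blocks: every exact identity in this class off the four families (YB curves on `u₁u₂v ≠ 0` at `t¹⁶ = −1`; degenerate family on `u₁u₂ ≠ 0`, `v = 0` at `t⁴ = 1`; the branch quartics on `u₁ = 0` / `u₂ = 0`, any phase); conversely it PROVIDES the identities on all four
- because: `u₁u₂ ≠ 0`: `PlaquetteWalkRowConvexClassification_holds` (above); `u₁ = 0` / `u₂ = 0`: the one-plaquette list is row-convex ⇒ the four rows ⇒ the quartic (`quartic_eq_zero_of_rows_of_u₁_eq_zero`), and the all-roots identities on the quartic (`PlaquetteWalkCornerBranchClassification`, no Yang–Baxter walk doubles all its corner plaquettes) descend by `toRC`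
- evasions_known: non-constant or root-dependent coefficients; multi-vertex or non-linear relations; other observables; other lattices — and, INSIDE the weight space, nothing: the statement covers all of `ℂ⁵ × {t ≠ 0}`
- scope_caveats: EXACT identities of the five-weight plaquette class only; `t = 0` excluded
- status: established — `PlaquetteWalkRowConvexClassificationAll_holds` (this file); print as for `PlaquetteWalkRowConvexClassification` ([cite: Glazman2015WeightedSAW, Lemma 3.1 (pp. 5–7, Appendix p. 12)] [cite: IkhlefCardy2009, §3]: local system, Cauchy–Riemann coefficients, real weights, `u₁u₂ ≠ 0`) — the all-of-`ℂ⁵` two-sided form is the venture lane's assembly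
[cite: Glazman2015WeightedSAW, Lemma 3.1] [cite: GlazmanManolescu2019, Lemma 2.1] -/
def _root_.Literature.Barriers.CriticalPhenomena.PlaquetteWalkRowConvexClassificationAll : Prop :=
  ∀ (W : CWeights) (t : ℂ), t ≠ 0 →
    ((∃ c : Fin 4 → ℂ, c ≠ 0 ∧ ExactPlaquetteVertexRelationRC W t c) ↔
      ((W.u₁ ≠ 0 ∧ W.u₂ ≠ 0 ∧ W.v ≠ 0 ∧ t ^ 16 = -1 ∧ ∃ ε r : ℂ, (ε = 1 ∨ ε = -1) ∧ W = ybCurve ε t r) ∨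
        (W.u₁ ≠ 0 ∧ W.u₂ ≠ 0 ∧ W.v = 0 ∧ t ^ 4 = 1 ∧
          ∃ ε s : ℂ, (ε = 1 ∨ ε = -1) ∧ (s = 1 ∨ s = -1) ∧ W = degenWeights ε s t W.u₁) ∨
        (W.u₁ = 0 ∧ (1 + W.v - W.u₂) * (1 + W.v + W.u₂) * (1 - W.v - W.u₂) * (1 - W.v + W.u₂) = 0) ∨
        (W.u₂ = 0 ∧ (1 + W.v - W.u₁) * (1 + W.v + W.u₁) * (1 - W.v - W.u₁) * (1 - W.v + W.u₁) = 0)))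

/-- **`PlaquetteWalkRowConvexClassificationAll` holds.** [cite: Glazman2015WeightedSAW, Lemma 3.1] -/
theorem _root_.Literature.Barriers.CriticalPhenomena.PlaquetteWalkRowConvexClassificationAll_holds :
    PlaquetteWalkRowConvexClassificationAll :=
  fun W _ ht => exactPlaquetteVertexRelationRC_iff_all W ht

/-- ★★ **The Yang–Baxter curves are exactly the weight systems whose identities need an outer root**: for
complex weights `W` and any phase `t ≠ 0`, a nonzero exact vertex relation exists on every ROW-CONVEX
face list for every boundary root but NOT on every face list for every boundary root (hole roots) iff
`u₁u₂v ≠ 0`, the spin is admissible (`t¹⁶ = −1`) and `W` lies on one of the sixteen Yang–Baxter curves —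
the two classifications `exactPlaquetteVertexRelationRC_iff_all` (this file) and
`exactPlaquetteVertexRelation_iff_allRoots` (`PlaquetteWalkAllRootsClassification`) subtracted.
[cite: Glazman2015WeightedSAW, Lemma 3.1 ("either v = 0 or σ = ℓ/8")] [cite: GlazmanManolescu2019, Lemma 2.1] -/
theorem rc_and_not_allRoots_iff_ybCurve (W : CWeights) {t : ℂ} (ht : t ≠ 0) :
    ((∃ c : Fin 4 → ℂ, c ≠ 0 ∧ ExactPlaquetteVertexRelationRC W t c) ∧
        ¬∃ c : Fin 4 → ℂ, c ≠ 0 ∧ ExactPlaquetteVertexRelation W t c) ↔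
      (W.u₁ ≠ 0 ∧ W.u₂ ≠ 0 ∧ W.v ≠ 0 ∧ t ^ 16 = -1 ∧ ∃ ε r : ℂ, (ε = 1 ∨ ε = -1) ∧ W = ybCurve ε t r) := by
  rw [exactPlaquetteVertexRelationRC_iff_all W ht, exactPlaquetteVertexRelation_iff_allRoots W ht]
  constructor
  · rintro ⟨h | h | h | h, hnot⟩
    · exact h
    · exact (hnot (Or.inl h)).elim
    · exact (hnot (Or.inr (Or.inl h))).elim
    · exact (hnot (Or.inr (Or.inr h))).elim
  · rintro ⟨h1, h2, hv, h16, hfam⟩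
    refine ⟨Or.inl ⟨h1, h2, hv, h16, hfam⟩, ?_⟩
    rintro (⟨-, -, hv', -⟩ | ⟨h1', -⟩ | ⟨h2', -⟩)
    · exact hv hv'
    · exact h1 h1'
    · exact h2 h2'

/-- **Corollary: every all-roots identity is a row-convex identity, and the converse fails exactly on the
Yang–Baxter curves** — restated as an implication for the record. [cite: GlazmanManolescu2019, Lemma 2.1] -/
theorem exists_rc_of_exists_allRoots (W : CWeights) {t : ℂ}
    (h : ∃ c : Fin 4 → ℂ, c ≠ 0 ∧ ExactPlaquetteVertexRelation W t c) :
    ∃ c : Fin 4 → ℂ, c ≠ 0 ∧ ExactPlaquetteVertexRelationRC W t c := by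
  obtain ⟨c, hc, hrel⟩ := h
  exact ⟨c, hc, hrel.toRC⟩

end BranchesRC

end PlaquetteWalk

end Literature.Barriers.CriticalPhenomena
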